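import Literature.Analysis.FluidPDE.TaoLocalisedEnstrophy
import HarnessLib

/-!
# Tao (2011/2013), proof of Thm. 10.1: a continuous Whitney decomposition of the annulus

Support file for the discharge of the nonlinear estimate `Y₆` of Tao 2011, §10 (arXiv:1108.1165,
proof of Thm. 10.1 = arXiv Thm. 59, pp. 31–33: "We apply a Whitney-type decomposition, covering
`Ω` by a boundedly overlapping collection of balls `Bᵢ = B(xᵢ, rᵢ)` with radius
`rᵢ := (1/100) min(dist(xᵢ, ∂Ω), c^{0.1}/δ²)`. In particular, we have `η ∼ c^{-0.1}δ²rᵢ` on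
`B(xᵢ, 10rᵢ)`"), in the annular geometry of Remark 10.6 (`Ω = {a < |x − x₀| < b}`, cutoff
`η = annularRamp k a b |· − x₀|` of slope `k`).

Instead of a discrete boundedly-overlapping cover we use the *continuous* family of all Whitney
balls `B(y, ρ(y))`, `ρ(y) = (1/100) min(d(y), k⁻¹)` (`d` the depth in the annulus), weighted by
`ρ(y)⁻³ dy`: every "bounded overlap" statement becomes a Tonelli computation with an explicit
kernel, and no covering lemma is needed.

* `annDepth x₀ a b x = min(|x − x₀| − a, b − |x − x₀|)` (the signed distance to `∂Ω`, positive
  exactly on `Ω`, `1`-Lipschitz) and `annularRamp k a b |x − x₀| = min(1, max(0, k d(x)))`;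
* `whitneyRadius x₀ a b k = max(0, min(d, k⁻¹))/100` (`(1/100)`-Lipschitz; on `Ω`,
  `100 k ρ = η`), comparability of `ρ` and of `η` on `B(y, cρ(y))`, `c < 100`;
* `lintegral_annulus_le_lintegral_whitney` — **the covering inequality**
  `∫_Ω Φ ≤ c₀⁻¹ ∫ ρ(y)⁻³ (∫_{B(y,ρ(y))} Φ) dy`;
* `lintegral_whitneyKernel_le` — **the overlap bound**
  `∫ ρ(y)⁻ᵐ 1[x ∈ B(y, cρ(y))] dy ≤ C ρ(x)^{3−m}`;
* `setIntegral_curl_sq_whitneyBall_le` — the trivial local bound from the localised enstrophy,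
  `∫_{B(y,cρ(y))} |ω|² ≤ 2W/((1 − c/100) η(y))` (Tao's (10.22)–(10.23), "`wᵢ ≲ c^{0.05}δ⁻¹W^{1/2}rᵢ⁻²`").

## Mathlib / tree search

Tree: `annularRamp` (`TaoMovingCutoff`), `localisedEnstrophy` (`TaoLocalisedEnstrophy`); no
Whitney decomposition in Mathlib or the tree (`lean search 'Whitney|whitney'`: none relevant).
Mathlib: `lintegral_lintegral_swap` (Tonelli), `Measure.addHaar_ball` (volume of balls),
`Measurable.lintegral_prod_right'`.

## References

* T. Tao, *Localisation and compactness properties of the Navier–Stokes global regularity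
  problem*, Anal. PDE 6 (2013) 25–107 = arXiv:1108.1165 (`Tao2011`), §10, proof of Thm. 10.1
  (the Whitney decomposition, (10.20), (10.22)–(10.23), arXiv p. 32) and Remark 10.6.
* E. M. Stein, *Singular integrals and differentiability properties of functions* (1970),
  Ch. VI §1 (Whitney decompositions).
-/

noncomputable section

open MeasureTheory Set Function Filter Metric Topology
open scoped ENNReal NNReal

namespace Literature.Analysis.FluidPDE

/-- Local notation for physical space `ℝ³ = EuclideanSpace ℝ (Fin 3)`. -/
local notation "ℝ³" => EuclideanSpace ℝ (Fin 3)

/-! ## The depth function of the annulus -/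

/-- The **depth** `d(x) = min(|x − x₀| − a, b − |x − x₀|)` of a point in the annulus
`Ω = {a < |x − x₀| < b}`: the distance to `∂Ω` inside `Ω` (positive exactly on `Ω`). [cite: Tao2011, §10, proof of Thm. 10.1 (dist(xᵢ, ∂Ω)) + Remark 10.6] -/
def annDepth (x₀ : ℝ³) (a b : ℝ) (x : ℝ³) : ℝ :=
  min (‖x - x₀‖ - a) (b - ‖x - x₀‖)

section Depth

variable {x₀ : ℝ³} {a b k : ℝ}

/-- Unfolding the depth. [folklore] -/
theorem annDepth_def (x₀ : ℝ³) (a b : ℝ) (x : ℝ³) :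
    annDepth x₀ a b x = min (‖x - x₀‖ - a) (b - ‖x - x₀‖) := rfl

/-- The depth is `1`-Lipschitz: `|d(x) − d(y)| ≤ |x − y|`. [folklore] -/
theorem abs_annDepth_sub_le (x₀ : ℝ³) (a b : ℝ) (x y : ℝ³) :
    |annDepth x₀ a b x - annDepth x₀ a b y| ≤ ‖x - y‖ := by
  have h := abs_norm_sub_norm_le (x - x₀) (y - x₀)
  rw [sub_sub_sub_cancel_right] at h
  rw [annDepth_def, annDepth_def, abs_le]
  rw [abs_le] at h
  constructor
  · rcases min_choice (‖x - x₀‖ - a) (b - ‖x - x₀‖) with h1 | h1 <;> rw [h1]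
    · linarith [min_le_left (‖y - x₀‖ - a) (b - ‖y - x₀‖)]
    · linarith [min_le_right (‖y - x₀‖ - a) (b - ‖y - x₀‖)]
  · rcases min_choice (‖y - x₀‖ - a) (b - ‖y - x₀‖) with h1 | h1 <;> rw [h1]
    · linarith [min_le_left (‖x - x₀‖ - a) (b - ‖x - x₀‖)]
    · linarith [min_le_right (‖x - x₀‖ - a) (b - ‖x - x₀‖)]

/-- The depth is `1`-Lipschitz. [folklore] -/
theorem lipschitzWith_annDepth (x₀ : ℝ³) (a b : ℝ) : LipschitzWith 1 (annDepth x₀ a b) :=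
  LipschitzWith.of_dist_le_mul fun x y => by
    rw [NNReal.coe_one, one_mul, Real.dist_eq, dist_eq_norm]
    exact abs_annDepth_sub_le x₀ a b x y

/-- The depth is continuous. [folklore] -/
theorem continuous_annDepth (x₀ : ℝ³) (a b : ℝ) : Continuous (annDepth x₀ a b) :=
  (lipschitzWith_annDepth x₀ a b).continuous

/-- Positive depth means membership in the open annulus. [folklore] -/
theorem annDepth_pos_iff (x : ℝ³) : 0 < annDepth x₀ a b x ↔ a < ‖x - x₀‖ ∧ ‖x - x₀‖ < b := by
  rw [annDepth_def, lt_min_iff, sub_pos, sub_pos]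

/-- The depth is at most half the width of the annulus. [folklore] -/
theorem two_mul_annDepth_le (x : ℝ³) : 2 * annDepth x₀ a b x ≤ b - a := by
  rw [annDepth_def]
  have h1 := min_le_left (‖x - x₀‖ - a) (b - ‖x - x₀‖)
  have h2 := min_le_right (‖x - x₀‖ - a) (b - ‖x - x₀‖)
  linarith

/-- **The annular ramp is a function of the depth**: `η(x) = min(1, max(0, k d(x)))`
(`k ≥ 0`). [cite: Tao2011, §10, proof of Thm. 10.1 (the cutoff η) + Remark 10.6] -/
theorem annularRamp_norm_sub_eq (hk : 0 ≤ k) (x : ℝ³) :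
    annularRamp k a b ‖x - x₀‖ = min 1 (max 0 (k * annDepth x₀ a b x)) := by
  rw [annularRamp_def, annDepth_def, ← max_min_distrib_left, mul_min_of_nonneg _ _ hk, min_comm
    (k * (‖x - x₀‖ - a))]

/-- Outside the open annulus the ramp vanishes. [folklore] -/
theorem annularRamp_norm_sub_eq_zero_of_annDepth_nonpos (hk : 0 ≤ k) {x : ℝ³}
    (hx : annDepth x₀ a b x ≤ 0) : annularRamp k a b ‖x - x₀‖ = 0 := by
  rw [annularRamp_norm_sub_eq hk, max_eq_left (mul_nonpos_of_nonneg_of_nonpos hk hx),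
    min_eq_right zero_le_one]

/-- On the layer `0 ≤ d ≤ k⁻¹` the ramp is linear in the depth: `η = k d`. [folklore] -/
theorem annularRamp_norm_sub_eq_mul_annDepth (hk : 0 < k) {x : ℝ³} (h0 : 0 ≤ annDepth x₀ a b x)
    (h1 : annDepth x₀ a b x ≤ k⁻¹) : annularRamp k a b ‖x - x₀‖ = k * annDepth x₀ a b x := by
  rw [annularRamp_norm_sub_eq hk.le, max_eq_right (mul_nonneg hk.le h0), min_eq_right]
  calc k * annDepth x₀ a b x ≤ k * k⁻¹ := mul_le_mul_of_nonneg_left h1 hk.le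
    _ = 1 := mul_inv_cancel₀ hk.ne'

/-- In general `η = min(1, k d)` on the closed annulus `d ≥ 0`. [folklore] -/
theorem annularRamp_norm_sub_eq_min (hk : 0 ≤ k) {x : ℝ³} (h0 : 0 ≤ annDepth x₀ a b x) :
    annularRamp k a b ‖x - x₀‖ = min 1 (k * annDepth x₀ a b x) := by
  rw [annularRamp_norm_sub_eq hk, max_eq_right (mul_nonneg hk h0)]

/-- The ramp is `k`-Lipschitz in space (`k ≥ 0`). [folklore] -/
theorem abs_annularRamp_norm_sub_sub_le (hk : 0 ≤ k) (x y : ℝ³) :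
    |annularRamp k a b ‖x - x₀‖ - annularRamp k a b ‖y - x₀‖| ≤ k * ‖x - y‖ := by
  have h := (lipschitzWith_annularRamp hk a b).dist_le_mul ‖x - x₀‖ ‖y - x₀‖
  rw [Real.dist_eq, Real.dist_eq, Real.coe_toNNReal _ hk] at h
  refine h.trans (mul_le_mul_of_nonneg_left ?_ hk)
  have h2 := abs_norm_sub_norm_le (x - x₀) (y - x₀)
  rwa [sub_sub_sub_cancel_right] at h2

end Depth

/-! ## The Whitney radius -/

/-- The **Whitney radius** `ρ(x) = (1/100) max(0, min(d(x), k⁻¹))` (Tao's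
`rᵢ = (1/100) min(dist(xᵢ, ∂Ω), c^{0.1}δ⁻²)` with `k⁻¹ = c^{0.1}δ⁻²`, extended by `0` off `Ω`). [cite: Tao2011, §10, proof of Thm. 10.1 (the radii rᵢ) + Remark 10.6] -/
def whitneyRadius (x₀ : ℝ³) (a b k : ℝ) (x : ℝ³) : ℝ :=
  max 0 (min (annDepth x₀ a b x) k⁻¹) / 100

section Radius

variable {x₀ : ℝ³} {a b k : ℝ}

/-- Unfolding the Whitney radius. [folklore] -/
theorem whitneyRadius_def (x₀ : ℝ³) (a b k : ℝ) (x : ℝ³) :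
    whitneyRadius x₀ a b k x = max 0 (min (annDepth x₀ a b x) k⁻¹) / 100 := rfl

/-- `ρ ≥ 0`. [folklore] -/
theorem whitneyRadius_nonneg (x₀ : ℝ³) (a b k : ℝ) (x : ℝ³) : 0 ≤ whitneyRadius x₀ a b k x :=
  div_nonneg (le_max_left _ _) (by norm_num)

/-- The Whitney radius is `(1/100)`-Lipschitz: `|ρ(x) − ρ(y)| ≤ |x − y|/100`. [folklore] -/
theorem abs_whitneyRadius_sub_le (x₀ : ℝ³) (a b k : ℝ) (x y : ℝ³) :
    |whitneyRadius x₀ a b k x - whitneyRadius x₀ a b k y| ≤ ‖x - y‖ / 100 := by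
  rw [whitneyRadius_def, whitneyRadius_def, ← sub_div, abs_div, abs_of_pos (by norm_num : (0:ℝ) < 100)]
  refine div_le_div_of_nonneg_right ?_ (by norm_num)
  have h1 : |min (annDepth x₀ a b x) k⁻¹ - min (annDepth x₀ a b y) k⁻¹| ≤ ‖x - y‖ :=
    (abs_min_sub_min_le_max _ _ _ _).trans (by
      rw [sub_self, abs_zero, max_eq_left (abs_nonneg _)]
      exact abs_annDepth_sub_le x₀ a b x y)
  exact (abs_max_sub_max_le_max _ _ _ _).trans (by
    rw [sub_self, abs_zero, max_eq_right (abs_nonneg _)]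
    exact h1)

/-- The Whitney radius is continuous. [folklore] -/
theorem continuous_whitneyRadius (x₀ : ℝ³) (a b k : ℝ) : Continuous (whitneyRadius x₀ a b k) :=
  (continuous_const.max ((continuous_annDepth x₀ a b).min continuous_const)).div_const _

/-- `100 ρ ≤ d` on the closed annulus side: `ρ(x) ≤ d(x)/100` whenever `d(x) ≥ 0`. [folklore] -/
theorem whitneyRadius_le_annDepth_div {x : ℝ³} (h0 : 0 ≤ annDepth x₀ a b x) :
    whitneyRadius x₀ a b k x ≤ annDepth x₀ a b x / 100 := by
  rw [whitneyRadius_def]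
  exact div_le_div_of_nonneg_right (max_le h0 (min_le_left _ _)) (by norm_num)

/-- `ρ ≤ k⁻¹/100` (`k > 0`). [folklore] -/
theorem whitneyRadius_le_inv_div (hk : 0 < k) (x : ℝ³) :
    whitneyRadius x₀ a b k x ≤ k⁻¹ / 100 := by
  rw [whitneyRadius_def]
  exact div_le_div_of_nonneg_right (max_le (inv_nonneg.2 hk.le) (min_le_right _ _)) (by norm_num)

/-- On the open annulus the Whitney radius is positive (`k > 0`). [folklore] -/
theorem whitneyRadius_pos (hk : 0 < k) {x : ℝ³} (hx : 0 < annDepth x₀ a b x) :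
    0 < whitneyRadius x₀ a b k x := by
  rw [whitneyRadius_def]
  exact div_pos (lt_max_of_lt_right (lt_min hx (inv_pos.2 hk))) (by norm_num)

/-- Off the open annulus the Whitney radius vanishes. [folklore] -/
theorem whitneyRadius_eq_zero {x : ℝ³} (hx : annDepth x₀ a b x ≤ 0) :
    whitneyRadius x₀ a b k x = 0 := by
  rw [whitneyRadius_def, max_eq_left ((min_le_left _ _).trans hx), zero_div]

/-- **`η = 100 k ρ` on the closed annulus** (`k > 0`, `d ≥ 0`). [cite: Tao2011, §10, proof of Thm. 10.1 ((10.20): η ∼ c^{-0.1}δ²rᵢ)] -/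
theorem annularRamp_eq_mul_whitneyRadius (hk : 0 < k) {x : ℝ³} (h0 : 0 ≤ annDepth x₀ a b x) :
    annularRamp k a b ‖x - x₀‖ = 100 * k * whitneyRadius x₀ a b k x := by
  rw [annularRamp_norm_sub_eq_min hk.le h0, whitneyRadius_def,
    max_eq_right (le_min h0 (inv_nonneg.2 hk.le))]
  have e : (100 : ℝ) * k * (min (annDepth x₀ a b x) k⁻¹ / 100) = k * min (annDepth x₀ a b x) k⁻¹ := by
    ring
  rw [e, mul_min_of_nonneg _ _ hk.le, mul_inv_cancel₀ hk.ne', min_comm]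

/-- The ramp in terms of the radius, everywhere (`k > 0`): both vanish off the annulus. [folklore] -/
theorem annularRamp_eq_mul_whitneyRadius' (hk : 0 < k) (x : ℝ³) :
    annularRamp k a b ‖x - x₀‖ = 100 * k * whitneyRadius x₀ a b k x := by
  rcases le_or_gt 0 (annDepth x₀ a b x) with h | h
  · exact annularRamp_eq_mul_whitneyRadius hk h
  · rw [annularRamp_norm_sub_eq_zero_of_annDepth_nonpos hk.le h.le, whitneyRadius_eq_zero h.le,
      mul_zero]

/-- **Whitney balls stay inside the annulus, quantitatively**: for `z ∈ B(y, cρ(y))`,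
`d(z) ≥ d(y) − cρ(y) ≥ (1 − c/100) d(y)` hence `d(z) > 0` when `c < 100` and `d(y) > 0`. [cite: Tao2011, §10, proof of Thm. 10.1 (B(xᵢ,10rᵢ) ⊆ Ω)] -/
theorem annDepth_pos_of_mem_ball {c : ℝ} (hc : c < 100) {y z : ℝ³} (hy : 0 < annDepth x₀ a b y)
    (hz : z ∈ ball y (c * whitneyRadius x₀ a b k y)) : 0 < annDepth x₀ a b z := by
  rw [mem_ball, dist_eq_norm] at hz
  have h1 := abs_annDepth_sub_le x₀ a b z y
  rw [abs_le] at h1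
  have h2 := whitneyRadius_le_annDepth_div (k := k) hy.le
  nlinarith [h1.1, whitneyRadius_nonneg x₀ a b k y]

/-- Comparability of the radii on a Whitney ball: `(1 − c/100) ρ(y) ≤ ρ(z)` for
`z ∈ B(y, cρ(y))`. [folklore] -/
theorem whitneyRadius_ge_of_mem_ball {c : ℝ} {y z : ℝ³}
    (hz : z ∈ ball y (c * whitneyRadius x₀ a b k y)) :
    (1 - c / 100) * whitneyRadius x₀ a b k y ≤ whitneyRadius x₀ a b k z := by
  rw [mem_ball, dist_eq_norm] at hz
  have h1 := abs_whitneyRadius_sub_le x₀ a b k z y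
  rw [abs_le] at h1
  nlinarith [h1.1]

/-- Comparability of the radii on a Whitney ball: `ρ(z) ≤ (1 + c/100) ρ(y)` for
`z ∈ B(y, cρ(y))`. [folklore] -/
theorem whitneyRadius_le_of_mem_ball {c : ℝ} {y z : ℝ³}
    (hz : z ∈ ball y (c * whitneyRadius x₀ a b k y)) :
    whitneyRadius x₀ a b k z ≤ (1 + c / 100) * whitneyRadius x₀ a b k y := by
  rw [mem_ball, dist_eq_norm] at hz
  have h1 := abs_whitneyRadius_sub_le x₀ a b k z y
  rw [abs_le] at h1
  nlinarith [h1.2]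

/-- **`η` is comparable to `η(y)` on a Whitney ball**, lower bound:
`(1 − c/100) η(y) ≤ η(z)` for `z ∈ B(y, cρ(y))` (`k > 0`). [cite: Tao2011, §10, proof of Thm. 10.1 ((10.20))] -/
theorem annularRamp_ge_of_mem_ball (hk : 0 < k) {c : ℝ} {y z : ℝ³}
    (hz : z ∈ ball y (c * whitneyRadius x₀ a b k y)) :
    (1 - c / 100) * annularRamp k a b ‖y - x₀‖ ≤ annularRamp k a b ‖z - x₀‖ := by
  rw [annularRamp_eq_mul_whitneyRadius' hk y, annularRamp_eq_mul_whitneyRadius' hk z]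
  have := whitneyRadius_ge_of_mem_ball hz
  nlinarith

/-- **`η` is comparable to `η(y)` on a Whitney ball**, upper bound:
`η(z) ≤ (1 + c/100) η(y)` for `z ∈ B(y, cρ(y))` (`k > 0`). [cite: Tao2011, §10, proof of Thm. 10.1 ((10.20))] -/
theorem annularRamp_le_of_mem_ball (hk : 0 < k) {c : ℝ} {y z : ℝ³}
    (hz : z ∈ ball y (c * whitneyRadius x₀ a b k y)) :
    annularRamp k a b ‖z - x₀‖ ≤ (1 + c / 100) * annularRamp k a b ‖y - x₀‖ := by
  rw [annularRamp_eq_mul_whitneyRadius' hk y, annularRamp_eq_mul_whitneyRadius' hk z]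
  have := whitneyRadius_le_of_mem_ball hz
  nlinarith

end Radius

/-! ## The covering inequality and the overlap bounds -/

section Kernel

variable {x₀ : ℝ³} {a b k : ℝ}

/-- The normalising constant `c₀ = vol(B(0,1)) / (8 · 1.01³)` of the continuous Whitney
decomposition. [folklore] -/
def whitneyConst : ℝ≥0∞ :=
  ENNReal.ofReal (1 / (8 * 1.01 ^ 3)) * volume (ball (0 : ℝ³) 1)

/-- `c₀ ≠ 0`. [folklore] -/
theorem whitneyConst_ne_zero : whitneyConst ≠ 0 := by
  rw [whitneyConst]
  refine mul_ne_zero ?_ (measure_ball_pos volume (0 : ℝ³) one_pos).ne'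
  rw [Ne, ENNReal.ofReal_eq_zero, not_le]
  positivity

/-- `c₀ ≠ ∞`. [folklore] -/
theorem whitneyConst_ne_top : whitneyConst ≠ ⊤ :=
  ENNReal.mul_ne_top ENNReal.ofReal_ne_top (measure_ball_lt_top).ne

/-- Volume of a ball in `ℝ³`: `vol B(x, r) = r³ vol B(0, 1)` (`r ≥ 0`). [folklore] -/
theorem volume_ball_eq (x : ℝ³) {r : ℝ} (hr : 0 ≤ r) :
    volume (ball x r) = ENNReal.ofReal (r ^ 3) * volume (ball (0 : ℝ³) 1) := by
  rw [Measure.addHaar_ball volume x hr, finrank_euclideanSpace_fin]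

/-- The **Whitney kernel** `K(y, z) = ρ(y)⁻ᵐ 1[z ∈ B(y, cρ(y))]` (weight of the centre `y`
seen from the point `z`). [folklore] -/
def whitneyKernel (x₀ : ℝ³) (a b k c : ℝ) (m : ℕ) (y z : ℝ³) : ℝ≥0∞ :=
  ENNReal.ofReal ((whitneyRadius x₀ a b k y)⁻¹ ^ m) *
    (ball y (c * whitneyRadius x₀ a b k y)).indicator 1 z

/-- Unfolding the Whitney kernel. [folklore] -/
theorem whitneyKernel_apply (x₀ : ℝ³) (a b k c : ℝ) (m : ℕ) (y z : ℝ³) :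
    whitneyKernel x₀ a b k c m y z = ENNReal.ofReal ((whitneyRadius x₀ a b k y)⁻¹ ^ m) *
      (ball y (c * whitneyRadius x₀ a b k y)).indicator 1 z := rfl

/-- The kernel off the ball. [folklore] -/
theorem whitneyKernel_of_notMem {c : ℝ} {m : ℕ} {y z : ℝ³}
    (h : z ∉ ball y (c * whitneyRadius x₀ a b k y)) : whitneyKernel x₀ a b k c m y z = 0 := by
  rw [whitneyKernel_apply, indicator_of_notMem h, mul_zero]

/-- The kernel on the ball. [folklore] -/
theorem whitneyKernel_of_mem {c : ℝ} {m : ℕ} {y z : ℝ³}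
    (h : z ∈ ball y (c * whitneyRadius x₀ a b k y)) :
    whitneyKernel x₀ a b k c m y z = ENNReal.ofReal ((whitneyRadius x₀ a b k y)⁻¹ ^ m) := by
  rw [whitneyKernel_apply, indicator_of_mem h, Pi.one_apply, mul_one]

/-- **Joint measurability of the Whitney kernel** (the set `{(y, z) : |z − y| < cρ(y)}` is
open). [folklore] -/
theorem measurable_whitneyKernel (x₀ : ℝ³) (a b k c : ℝ) (m : ℕ) :
    Measurable (uncurry (whitneyKernel x₀ a b k c m)) := by
  have h1 : Continuous fun p : ℝ³ × ℝ³ => dist p.2 p.1 := continuous_snd.dist continuous_fst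
  have h2 : Continuous fun p : ℝ³ × ℝ³ => c * whitneyRadius x₀ a b k p.1 :=
    continuous_const.mul ((continuous_whitneyRadius x₀ a b k).comp continuous_fst)
  have hS : MeasurableSet {p : ℝ³ × ℝ³ | dist p.2 p.1 < c * whitneyRadius x₀ a b k p.1} :=
    (isOpen_lt h1 h2).measurableSet
  have e : uncurry (whitneyKernel x₀ a b k c m) = fun p =>
      ENNReal.ofReal ((whitneyRadius x₀ a b k p.1)⁻¹ ^ m) *
        {p : ℝ³ × ℝ³ | dist p.2 p.1 < c * whitneyRadius x₀ a b k p.1}.indicator 1 p := by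
    funext p
    rw [uncurry, whitneyKernel_apply]
    by_cases h : dist p.2 p.1 < c * whitneyRadius x₀ a b k p.1
    · rw [indicator_of_mem (mem_ball.2 h), indicator_of_mem (by exact h)]
      rfl
    · rw [indicator_of_notMem (fun h' => h (mem_ball.1 h')), indicator_of_notMem (by exact h)]
  rw [e]
  refine (ENNReal.measurable_ofReal.comp ?_).mul (measurable_one.indicator hS)
  exact ((measurable_inv.comp (continuous_whitneyRadius x₀ a b k).measurable).pow_const m).comp
    measurable_fst

/-- Measurability of the kernel in the centre variable. [folklore] -/
theorem measurable_whitneyKernel_left (x₀ : ℝ³) (a b k c : ℝ) (m : ℕ) (z : ℝ³) :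
    Measurable fun y => whitneyKernel x₀ a b k c m y z :=
  (measurable_whitneyKernel x₀ a b k c m).of_uncurry_right

/-- Measurability of the kernel in the point variable. [folklore] -/
theorem measurable_whitneyKernel_right (x₀ : ℝ³) (a b k c : ℝ) (m : ℕ) (y : ℝ³) :
    Measurable fun z => whitneyKernel x₀ a b k c m y z :=
  (measurable_whitneyKernel x₀ a b k c m).of_uncurry_left

/-- Integrating against the kernel in the point variable is the weighted ball integral:
`∫ K(y, z) Φ(z) dz = ρ(y)⁻ᵐ ∫_{B(y, cρ(y))} Φ`. [folklore] -/
theorem lintegral_whitneyKernel_mul (x₀ : ℝ³) (a b k c : ℝ) (m : ℕ) (y : ℝ³) (Φ : ℝ³ → ℝ≥0∞) :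
    ∫⁻ z, whitneyKernel x₀ a b k c m y z * Φ z =
      ENNReal.ofReal ((whitneyRadius x₀ a b k y)⁻¹ ^ m) *
        ∫⁻ z in ball y (c * whitneyRadius x₀ a b k y), Φ z := by
  rw [← lintegral_indicator measurableSet_ball, ← lintegral_const_mul' _ _ ENNReal.ofReal_ne_top]
  refine lintegral_congr fun z => ?_
  by_cases h : z ∈ ball y (c * whitneyRadius x₀ a b k y)
  · rw [whitneyKernel_of_mem h, indicator_of_mem h]
  · rw [whitneyKernel_of_notMem h, indicator_of_notMem h, zero_mul, mul_zero]

/-- **Lower bound for the Whitney kernel**: every point `z` of the open annulus is covered with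
weight at least `c₀`: `c₀ ≤ ∫ ρ(y)⁻³ 1[z ∈ B(y, ρ(y))] dy` (the balls centred in
`B(z, ρ(z)/2)` all contain `z` and have comparable radius). [cite: Tao2011, §10, proof of Thm. 10.1 (the Whitney cover)] -/
theorem whitneyConst_le_lintegral_kernel (hk : 0 < k) {z : ℝ³} (hz : 0 < annDepth x₀ a b z) :
    whitneyConst ≤ ∫⁻ y, whitneyKernel x₀ a b k 1 3 y z := by
  set ρ := whitneyRadius x₀ a b k with hρ
  have hρz : 0 < ρ z := whitneyRadius_pos hk hz
  -- on `B(z, ρ(z)/2)` the integrand is at least `(1.01 ρ(z))⁻³`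
  have hpt : ∀ y ∈ ball z (ρ z / 2), ENNReal.ofReal ((1.01 * ρ z)⁻¹ ^ 3) ≤
      whitneyKernel x₀ a b k 1 3 y z := by
    intro y hy
    rw [mem_ball, dist_eq_norm] at hy
    have h1 := abs_whitneyRadius_sub_le x₀ a b k y z
    rw [← hρ, abs_le] at h1
    have hρy : 0 < ρ y := by nlinarith [h1.1]
    have hzy : z ∈ ball y (1 * whitneyRadius x₀ a b k y) := by
      rw [mem_ball, dist_eq_norm, ← norm_neg, neg_sub, one_mul, ← hρ]; nlinarith [h1.1]
    rw [whitneyKernel_of_mem hzy, ← hρ]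
    refine ENNReal.ofReal_le_ofReal (pow_le_pow_left₀ (inv_nonneg.2 (by positivity)) ?_ 3)
    exact inv_anti₀ hρy (by nlinarith [h1.2])
  calc whitneyConst = ENNReal.ofReal ((1.01 * ρ z)⁻¹ ^ 3) * volume (ball z (ρ z / 2)) := by
        rw [whitneyConst, volume_ball_eq z (by positivity : (0:ℝ) ≤ ρ z / 2), ← mul_assoc,
          ← ENNReal.ofReal_mul (by positivity)]
        congr 2
        field_simp
        norm_num
    _ = ∫⁻ y in ball z (ρ z / 2), ENNReal.ofReal ((1.01 * ρ z)⁻¹ ^ 3) := by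
        rw [setLIntegral_const]
    _ ≤ ∫⁻ y in ball z (ρ z / 2), whitneyKernel x₀ a b k 1 3 y z :=
        setLIntegral_mono' measurableSet_ball hpt
    _ ≤ ∫⁻ y, whitneyKernel x₀ a b k 1 3 y z := setLIntegral_le_lintegral _ _

/-- **The covering inequality of the continuous Whitney decomposition**: for every measurable
`Φ ≥ 0`, `∫_Ω Φ ≤ c₀⁻¹ ∫ ρ(y)⁻³ (∫_{B(y, ρ(y))} Φ) dy` (Tonelli and the lower bound for the
kernel). This replaces "`|Y₆| ≲ … Σᵢ …`" over a discrete Whitney cover. [cite: Tao2011, §10, proof of Thm. 10.1 (the Whitney cover)] -/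
theorem lintegral_annulus_le_lintegral_whitney (hk : 0 < k) {Φ : ℝ³ → ℝ≥0∞} (hΦ : Measurable Φ) :
    ∫⁻ z in {z | 0 < annDepth x₀ a b z}, Φ z ≤
      whitneyConst⁻¹ * ∫⁻ y, ENNReal.ofReal ((whitneyRadius x₀ a b k y)⁻¹ ^ 3) *
        ∫⁻ z in ball y (1 * whitneyRadius x₀ a b k y), Φ z := by
  have hΩ : MeasurableSet {z : ℝ³ | 0 < annDepth x₀ a b z} :=
    (isOpen_lt continuous_const (continuous_annDepth x₀ a b)).measurableSet
  have hKm : Measurable (uncurry fun z y => whitneyKernel x₀ a b k 1 3 y z * Φ z) := by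
    have e : (uncurry fun z y => whitneyKernel x₀ a b k 1 3 y z * Φ z) =
        fun p : ℝ³ × ℝ³ => uncurry (whitneyKernel x₀ a b k 1 3) (p.2, p.1) * Φ p.1 := rfl
    rw [e]
    exact ((measurable_whitneyKernel x₀ a b k 1 3).comp measurable_swap).mul (hΦ.comp measurable_fst)
  -- pointwise: `1_Ω Φ ≤ (c₀⁻¹ ∫ K) Φ`
  have hpt : ∀ z, {z : ℝ³ | 0 < annDepth x₀ a b z}.indicator Φ z ≤
      (whitneyConst⁻¹ * ∫⁻ y, whitneyKernel x₀ a b k 1 3 y z) * Φ z := by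
    intro z
    by_cases hz : z ∈ {z : ℝ³ | 0 < annDepth x₀ a b z}
    · rw [indicator_of_mem hz]
      have h1 : 1 ≤ whitneyConst⁻¹ * ∫⁻ y, whitneyKernel x₀ a b k 1 3 y z := by
        calc (1 : ℝ≥0∞) = whitneyConst⁻¹ * whitneyConst :=
              (ENNReal.inv_mul_cancel whitneyConst_ne_zero whitneyConst_ne_top).symm
          _ ≤ whitneyConst⁻¹ * ∫⁻ y, whitneyKernel x₀ a b k 1 3 y z :=
              mul_le_mul' le_rfl (whitneyConst_le_lintegral_kernel hk hz)
      calc Φ z = 1 * Φ z := (one_mul _).symm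
        _ ≤ (whitneyConst⁻¹ * ∫⁻ y, whitneyKernel x₀ a b k 1 3 y z) * Φ z := mul_le_mul' h1 le_rfl
    · rw [indicator_of_notMem hz]
      exact bot_le
  calc ∫⁻ z in {z | 0 < annDepth x₀ a b z}, Φ z
      = ∫⁻ z, {z : ℝ³ | 0 < annDepth x₀ a b z}.indicator Φ z := (lintegral_indicator hΩ _).symm
    _ ≤ ∫⁻ z, (whitneyConst⁻¹ * ∫⁻ y, whitneyKernel x₀ a b k 1 3 y z) * Φ z := lintegral_mono hpt
    _ = whitneyConst⁻¹ * ∫⁻ z, ∫⁻ y, whitneyKernel x₀ a b k 1 3 y z * Φ z := by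
        rw [← lintegral_const_mul' _ _ (ENNReal.inv_ne_top.2 whitneyConst_ne_zero)]
        refine lintegral_congr fun z => ?_
        rw [mul_assoc, lintegral_mul_const _ (measurable_whitneyKernel_left x₀ a b k 1 3 z)]
    _ = whitneyConst⁻¹ * ∫⁻ y, ∫⁻ z, whitneyKernel x₀ a b k 1 3 y z * Φ z := by
        rw [lintegral_lintegral_swap hKm.aemeasurable]
    _ = whitneyConst⁻¹ * ∫⁻ y, ENNReal.ofReal ((whitneyRadius x₀ a b k y)⁻¹ ^ 3) *
          ∫⁻ z in ball y (1 * whitneyRadius x₀ a b k y), Φ z := by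
        congr 1
        exact lintegral_congr fun y => lintegral_whitneyKernel_mul x₀ a b k 1 3 y Φ

/-- **The overlap bound of the continuous Whitney decomposition**: the total weight of the
centres `y` whose ball `B(y, cρ(y))` contains a given point `x` is controlled by the local
scale, `∫ ρ(y)⁻ᵐ 1[x ∈ B(y, cρ(y))] dy ≤ (1 + c/100)ᵐ (c/(1 − c/100))³ vol B(0,1) · ρ(x)³ρ(x)⁻ᵐ`
(all such `y` lie in `B(x, cρ(x)/(1 − c/100))` and have `ρ(y) ≥ ρ(x)/(1 + c/100)`). This is the
"bounded overlap of the `Bᵢ`" of the printed proof. [cite: Tao2011, §10, proof of Thm. 10.1 (bounded overlap of the Whitney balls)] -/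
theorem lintegral_whitneyKernel_le {c : ℝ} (hc0 : 0 ≤ c) (hc : c < 100) (m : ℕ) (x : ℝ³) :
    ∫⁻ y, whitneyKernel x₀ a b k c m y x ≤
      ENNReal.ofReal ((1 + c / 100) ^ m * (c / (1 - c / 100)) ^ 3 *
        (whitneyRadius x₀ a b k x ^ 3 * (whitneyRadius x₀ a b k x)⁻¹ ^ m)) *
          volume (ball (0 : ℝ³) 1) := by
  set ρ := whitneyRadius x₀ a b k with hρ
  have hc1 : 0 < 1 - c / 100 := by linarith
  have hρx : 0 ≤ ρ x := whitneyRadius_nonneg x₀ a b k x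
  -- pointwise domination by a constant on the ball `B(x, cρ(x)/(1 - c/100))`
  have hpt : ∀ y, whitneyKernel x₀ a b k c m y x ≤
      ENNReal.ofReal ((1 + c / 100) ^ m * (ρ x)⁻¹ ^ m) *
        (ball x (c / (1 - c / 100) * ρ x)).indicator 1 y := by
    intro y
    by_cases hy : x ∈ ball y (c * whitneyRadius x₀ a b k y)
    · have hlo := whitneyRadius_ge_of_mem_ball hy
      have hhi := whitneyRadius_le_of_mem_ball hy
      rw [← hρ] at hlo hhi
      have hyx : dist x y < c * ρ y := mem_ball.1 hy
      have hρy : 0 < ρ y := by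
        by_contra h0
        have : c * ρ y ≤ 0 := by nlinarith [whitneyRadius_nonneg x₀ a b k y, dist_nonneg (x := x) (y := y)]
        linarith [dist_nonneg (x := x) (y := y)]
      have hρx' : 0 < ρ x := lt_of_lt_of_le (mul_pos hc1 hρy) hlo
      have hmem : y ∈ ball x (c / (1 - c / 100) * ρ x) := by
        rw [mem_ball, dist_comm]
        calc dist x y < c * ρ y := hyx
          _ ≤ c * (ρ x / (1 - c / 100)) := by
              refine mul_le_mul_of_nonneg_left ?_ hc0
              rw [le_div_iff₀ hc1]; linarith
          _ = c / (1 - c / 100) * ρ x := by ring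
      rw [whitneyKernel_of_mem hy, indicator_of_mem hmem, Pi.one_apply, mul_one, ← hρ]
      refine ENNReal.ofReal_le_ofReal ?_
      rw [← mul_pow]
      refine pow_le_pow_left₀ (inv_nonneg.2 hρy.le) ?_ m
      rw [inv_le_comm₀ hρy (by positivity), mul_inv, inv_inv, ← div_eq_inv_mul, div_le_iff₀ (by positivity)]
      linarith
    · rw [whitneyKernel_of_notMem hy]
      exact bot_le
  calc ∫⁻ y, whitneyKernel x₀ a b k c m y x
      ≤ ∫⁻ y, ENNReal.ofReal ((1 + c / 100) ^ m * (ρ x)⁻¹ ^ m) *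
          (ball x (c / (1 - c / 100) * ρ x)).indicator 1 y := lintegral_mono hpt
    _ = ENNReal.ofReal ((1 + c / 100) ^ m * (ρ x)⁻¹ ^ m) * volume (ball x (c / (1 - c / 100) * ρ x)) := by
        rw [lintegral_const_mul' _ _ ENNReal.ofReal_ne_top, lintegral_indicator_one measurableSet_ball]
    _ = ENNReal.ofReal ((1 + c / 100) ^ m * (c / (1 - c / 100)) ^ 3 * (ρ x ^ 3 * (ρ x)⁻¹ ^ m)) *
          volume (ball (0 : ℝ³) 1) := by
        rw [volume_ball_eq x (by positivity), ← mul_assoc, ← ENNReal.ofReal_mul (by positivity)]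
        congr 2
        ring

/-- The overlap bound with exponent `3` (counting the balls through a point):
`∫ ρ(y)⁻³ 1[x ∈ B(y, cρ(y))] dy ≤ (1 + c/100)³ (c/(1 − c/100))³ vol B(0,1)`. [cite: Tao2011, §10, proof of Thm. 10.1 (bounded overlap of the Whitney balls)] -/
theorem lintegral_whitneyKernel_three_le {c : ℝ} (hc0 : 0 ≤ c) (hc : c < 100) (x : ℝ³) :
    ∫⁻ y, whitneyKernel x₀ a b k c 3 y x ≤
      ENNReal.ofReal ((1 + c / 100) ^ 3 * (c / (1 - c / 100)) ^ 3) * volume (ball (0 : ℝ³) 1) := by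
  refine (lintegral_whitneyKernel_le hc0 hc 3 x).trans (mul_le_mul' (ENNReal.ofReal_le_ofReal ?_) le_rfl)
  have h1 : 0 ≤ (1 + c / 100) ^ 3 * (c / (1 - c / 100)) ^ 3 := by
    have : 0 < 1 - c / 100 := by linarith
    positivity
  refine mul_le_of_le_one_right h1 ?_
  rw [← mul_pow]
  by_cases h : whitneyRadius x₀ a b k x = 0
  · rw [h]; norm_num
  · rw [mul_inv_cancel₀ h, one_pow]

/-- The overlap bound with exponent `2` (the weight `Σᵢ rᵢ 1_{3Bᵢ} ≲ dist(·, ∂Ω)` of the printed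
proof): `∫ ρ(y)⁻² 1[x ∈ B(y, cρ(y))] dy ≤ (1 + c/100)² (c/(1 − c/100))³ vol B(0,1) · ρ(x)`. [cite: Tao2011, §10, proof of Thm. 10.1 ("by (10.20) and the bounded overlap")] -/
theorem lintegral_whitneyKernel_two_le {c : ℝ} (hc0 : 0 ≤ c) (hc : c < 100) (x : ℝ³) :
    ∫⁻ y, whitneyKernel x₀ a b k c 2 y x ≤
      ENNReal.ofReal ((1 + c / 100) ^ 2 * (c / (1 - c / 100)) ^ 3 * whitneyRadius x₀ a b k x) *
        volume (ball (0 : ℝ³) 1) := by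
  refine (lintegral_whitneyKernel_le hc0 hc 2 x).trans (le_of_eq ?_)
  congr 2
  by_cases h : whitneyRadius x₀ a b k x = 0
  · rw [h]; simp
  · field_simp

end Kernel

/-! ## Local bounds from the localised enstrophy -/

section Local

variable {x₀ : ℝ³} {a b k : ℝ}

/-- The ramp has compact support (it vanishes off `B̄(x₀, b)`). [folklore] -/
theorem hasCompactSupport_mul_annularRamp (hk : 0 ≤ k) (g : ℝ³ → ℝ) :
    HasCompactSupport fun x => g x * annularRamp k a b ‖x - x₀‖ := by
  refine HasCompactSupport.intro (isCompact_closedBall x₀ b) fun x hx => ?_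
  rw [mem_closedBall, dist_eq_norm, not_le] at hx
  rw [annularRamp_eq_zero_of_outer_le hk hx.le, mul_zero]

/-- A continuous function against the ramp is integrable. [folklore] -/
theorem integrable_mul_annularRamp (hk : 0 ≤ k) {g : ℝ³ → ℝ} (hg : Continuous g) :
    Integrable fun x => g x * annularRamp k a b ‖x - x₀‖ :=
  (hg.mul ((continuous_annularRamp hk a b).comp (continuous_id.sub continuous_const).norm)).integrable_of_hasCompactSupport
    (hasCompactSupport_mul_annularRamp hk g)

/-- **Local mass from the weighted mass**: for a continuous `g ≥ 0` and a centre `y` of the open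
annulus, `(1 − c/100) η(y) ∫_{B(y, cρ(y))} g ≤ ∫ g η` (`0 ≤ c < 100`), since
`η ≥ (1 − c/100) η(y)` on the Whitney ball. [cite: Tao2011, §10, proof of Thm. 10.1 ((10.20), (10.22))] -/
theorem mul_setIntegral_whitneyBall_le (hk : 0 < k) (c : ℝ) (y : ℝ³) {g : ℝ³ → ℝ}
    (hg : Continuous g) (hg0 : ∀ x, 0 ≤ g x) :
    (1 - c / 100) * annularRamp k a b ‖y - x₀‖ *
        ∫ z in ball y (c * whitneyRadius x₀ a b k y), g z ≤
      ∫ z, g z * annularRamp k a b ‖z - x₀‖ := by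
  have hint := integrable_mul_annularRamp (x₀ := x₀) (a := a) (b := b) hk.le hg
  have hgi : IntegrableOn g (ball y (c * whitneyRadius x₀ a b k y)) volume :=
    (hg.continuousOn.integrableOn_compact (isCompact_closedBall y _)).mono_set ball_subset_closedBall
  rw [← integral_const_mul]
  calc ∫ z in ball y (c * whitneyRadius x₀ a b k y), (1 - c / 100) * annularRamp k a b ‖y - x₀‖ * g z
      ≤ ∫ z in ball y (c * whitneyRadius x₀ a b k y), g z * annularRamp k a b ‖z - x₀‖ := by
        refine setIntegral_mono_on (hgi.const_mul _) hint.integrableOn measurableSet_ball fun z hz => ?_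
        rw [mul_comm (g z)]
        exact mul_le_mul_of_nonneg_right (annularRamp_ge_of_mem_ball hk hz) (hg0 z)
    _ ≤ ∫ z, g z * annularRamp k a b ‖z - x₀‖ :=
        setIntegral_le_integral hint (Eventually.of_forall fun z => mul_nonneg (hg0 z) (annularRamp_nonneg _ _ _ _))

/-- **`‖ω‖²_{L²(B(y,cρ(y)))} ≤ 2W/((1 − c/100)η(y))`** for a centre `y` of the open annulus
(Tao's (10.22)–(10.23): "`Σᵢ rᵢ⁴wᵢ² ≲ c^{0.1}δ⁻²W` and in particular
`wᵢ ≲ c^{0.05}δ⁻¹W^{1/2}rᵢ⁻²`"). [cite: Tao2011, §10, proof of Thm. 10.1 ((10.22)–(10.23))] -/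
theorem setIntegral_curl_sq_whitneyBall_le (hk : 0 < k) {c : ℝ} (hc : c < 100) {y : ℝ³}
    (hy : 0 < annDepth x₀ a b y) {u : ℝ³ → ℝ³} (hω : Continuous (FluidPDE.curl u)) :
    ∫ z in ball y (c * whitneyRadius x₀ a b k y), ‖FluidPDE.curl u z‖ ^ 2 ≤
      2 * localisedEnstrophy (fun x => annularRamp k a b ‖x - x₀‖) u /
        ((1 - c / 100) * annularRamp k a b ‖y - x₀‖) := by
  have hη : 0 < annularRamp k a b ‖y - x₀‖ := by
    rw [annularRamp_eq_mul_whitneyRadius hk hy.le]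
    exact mul_pos (by positivity) (whitneyRadius_pos hk hy)
  have hc1 : 0 < 1 - c / 100 := by linarith
  have hcont : Continuous fun x => ‖FluidPDE.curl u x‖ ^ 2 := hω.norm.pow 2
  have h := mul_setIntegral_whitneyBall_le (x₀ := x₀) (a := a) (b := b) hk c y hcont fun x => sq_nonneg _
  rw [le_div_iff₀ (mul_pos hc1 hη), localisedEnstrophy_def]
  calc (∫ z in ball y (c * whitneyRadius x₀ a b k y), ‖FluidPDE.curl u z‖ ^ 2) *
        ((1 - c / 100) * annularRamp k a b ‖y - x₀‖)
      = (1 - c / 100) * annularRamp k a b ‖y - x₀‖ *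
          ∫ z in ball y (c * whitneyRadius x₀ a b k y), ‖FluidPDE.curl u z‖ ^ 2 := by ring
    _ ≤ ∫ z, ‖FluidPDE.curl u z‖ ^ 2 * annularRamp k a b ‖z - x₀‖ := h
    _ = 2 * (1 / 2 * ∫ z, ‖FluidPDE.curl u z‖ ^ 2 * annularRamp k a b ‖z - x₀‖) := by ring

/-- **`‖∇ω‖²_{L²(B(y,cρ(y)))} ≤ Y₁/((1 − c/100)η(y))`** (Frobenius norm) for a centre `y` of the
open annulus. [cite: Tao2011, §10, proof of Thm. 10.1 ((10.20): "Σᵢ rᵢ‖∇ω‖²_{L²(3Bᵢ)} ≲ c^{0.1}δ⁻²∫|∇ω|²η")] -/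
theorem setIntegral_frobenius_whitneyBall_le (hk : 0 < k) {c : ℝ} (hc : c < 100) {y : ℝ³}
    (hy : 0 < annDepth x₀ a b y) {u : ℝ³ → ℝ³} (hu : ContDiff ℝ 2 u) :
    ∫ z in ball y (c * whitneyRadius x₀ a b k y),
        FluidPDE.frobeniusNormSq (fderiv ℝ (FluidPDE.curl u) z) ≤
      localisedEnstrophyDissipation (fun x => annularRamp k a b ‖x - x₀‖) u /
        ((1 - c / 100) * annularRamp k a b ‖y - x₀‖) := by
  have hη : 0 < annularRamp k a b ‖y - x₀‖ := by
    rw [annularRamp_eq_mul_whitneyRadius hk hy.le]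
    exact mul_pos (by positivity) (whitneyRadius_pos hk hy)
  have hc1 : 0 < 1 - c / 100 := by linarith
  have hcont : Continuous fun z => FluidPDE.frobeniusNormSq (fderiv ℝ (FluidPDE.curl u) z) :=
    FluidPDE.continuous_frobeniusNormSq_fderiv (FluidPDE.contDiff_curl (n := 1) hu) one_ne_zero
  have h := mul_setIntegral_whitneyBall_le (x₀ := x₀) (a := a) (b := b) hk c y hcont fun x =>
    FluidPDE.frobeniusNormSq_nonneg _
  rw [le_div_iff₀ (mul_pos hc1 hη), localisedEnstrophyDissipation_def]
  calc (∫ z in ball y (c * whitneyRadius x₀ a b k y),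
        FluidPDE.frobeniusNormSq (fderiv ℝ (FluidPDE.curl u) z)) *
        ((1 - c / 100) * annularRamp k a b ‖y - x₀‖)
      = (1 - c / 100) * annularRamp k a b ‖y - x₀‖ *
          ∫ z in ball y (c * whitneyRadius x₀ a b k y),
            FluidPDE.frobeniusNormSq (fderiv ℝ (FluidPDE.curl u) z) := by ring
    _ ≤ _ := h

end Local

end Literature.Analysis.FluidPDE

end
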